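import Mathlib
import HarnessLib
import Summits.HubbardSuperconductivity.HubbardSuperconductivity.Theorems.KLProgrammeKLRegimeSplitEngineV9

/-!
# Route `KLProgramme` — crux K3 (stmt-HubbardSuperconductivity-19937), CHILD 1 on the WICK carriers (E2-STRUCTURE option (B)):
# the per-scale step `BetaSplitAtW n` from row 0′'s `PairArrayAtW n`, (E5-W) `IsoTupleL1AtW n` and (E4-W) `EngineFirstMomentsW n`

Cell gate-hubbard-kl, seat hubbard-kl-k3c1-p2 (g6; child-1 re-closure lineage; technique «row-0′ V4/S twin induction measured from its own constant»).
Context (cell STATUS 2026-08-27 02:00–02:50Z, plan g12 (R12′)/(R13)): p1 g8's `…KLRegimeSplitEngineV9` types, next to the repaired plain engine slot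
(E2-v9), every value / kernel conjunct of the engine and split slots on the WICK-ORDERED carriers (`…KLRegimeWickCarriersDefs`, p484936):
`EngineBoundsAtW9S` ∋ (E5-W) `IsoTupleL1AtW`, (E4-W) `EngineFirstMomentsW`; split side `BetaSplitAtW := PairArrayAtW ∧ (EndpointNormLineIsoW ∧
QuarticValueLineW) ∧ FirstMomentsW`.  Under option (B) the bundle reads these twins and child 1 is re-closed on them; this file is the PER-SCALE STEP
of that re-closure — the Wick twins, token for token, of `quarticValueS2_le_of_pairArrayAtV2` / `quarticValueLineS_of_pairArrayAtV2` /
`endpointLineS_of_V2` (`…SplitChildOneClosersS2`, p1), `firstMoments_of_engineFirstMoments` (`…SplitChildOneClosers`, p1) and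
`betaSplitAtS2_of_pairArrayAtV2` (`…SplitChildOneStepS2`, p1b) — proofs adapted from those files: **`wickQuarticValueS_le_of_pairArrayAtW`** (every
`(0,1)` triple is pair kinematics at `Q = k₁ + k₃`, through p1's `wickQuarticValue_pair_le_of_pairArrayAtW`), **`quarticValueLineW_of_pairArrayAtW`**,
`klWickIsoKernelAt_self` (`rfl`: read at its own resolution the (E5-W) carrier is the (B2-W iso) carrier), **`endpointNormLineIsoW_of_pairArrayAtW`**
((B1-W) + (E5-W) ⇒ (B2-W iso)), **`firstMomentsW_of_engineFirstMomentsW`**, **`betaSplitAtW_of_pairArrayAtW`** (side conditions `CF·B₂ + CF·(Klam U)² ≤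
Klam|U|`, `B₂ ≤ Klam|U|`, `cE4 + cE4′|U| ≤ Cd`, `B₂ := 2|U| + (C_W + klLegKappa·CR·Klam³)·U²` — the plain ones verbatim).  Row 0′ itself on the Wick
carrier (`pairArrayAtW_of_edgeClauses_explicit`) and the generic / slot-level closers are the next files.  Everything is proved; no definitions;
nothing about the model is asserted.
-/

noncomputable section

namespace Summit.HubbardSuperconductivity.HubbardSuperconductivity.Theorems.KLRegimeSplit

set_option linter.dupNamespace false -- summit = problem name (single-conjunct summit), D-0017

open Literature.MathematicalPhysics.QuantumLattice Literature.Probability.LatticeModels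
open Summit.HubbardSuperconductivity.HubbardSuperconductivity.Theorems.KLRegimeWick

section Model

variable (L M : ℕ) [NeZero L] [NeZero M]

/-- **Pair-class `(0,1)` Wick values at `(k₁, k₂, k₃)` with `k₁, k₂` in the ball (any `k₃`)** from (B1-W) `PairArrayAtW n` (every triple is pair
kinematics at total momentum `k₁ + k₃`; twin of `quarticValueS2_le_of_pairArrayAtV2`). -/
theorem wickQuarticValueS_le_of_pairArrayAtW (P : SplitConsts) (Q : EngConsts) {β U μ : ℝ} {K : TrigPolyC4v} {n : ℕ}
    (h : PairArrayAtW L M P Q β U μ K n) {k₁ k₂ : TorusSite 2 L} (hk₁ : k₁ ∈ klBall L μ K) (hk₂ : k₂ ∈ klBall L μ K)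
    (k₃ : TorusSite 2 L) :
    ‖klWickQuarticValue L M β U μ K n 0 1 k₁ k₂ k₃‖ ≤ 2 * |U| + (P.C_W + klLegKappa * Q.CR * P.Klam ^ 3) * U ^ 2 := by
  have hk₃ : k₃ = (k₁ + k₃) - k₁ := by abel
  rw [hk₃]
  exact wickQuarticValue_pair_le_of_pairArrayAtW h (k₁ + k₃) hk₂ hk₁

/-- **The `(0,1)` Wick value line (B2-W value) from (B1-W) alone** (given `2|U| + (C_W + κ₀·CR·Klam³)U² ≤ Klam·|U|`). -/
theorem quarticValueLineW_of_pairArrayAtW (P : SplitConsts) (Q : EngConsts) {β U μ : ℝ} {K : TrigPolyC4v} {n : ℕ}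
    (h : PairArrayAtW L M P Q β U μ K n) (hK : 2 * |U| + (P.C_W + klLegKappa * Q.CR * P.Klam ^ 3) * U ^ 2 ≤ P.Klam * |U|) :
    QuarticValueLineW L M P β U μ K n :=
  fun _ hk₁ _ hk₂ k₃ _ => (wickQuarticValueS_le_of_pairArrayAtW L M P Q h hk₁ hk₂ k₃).trans hK

omit [NeZero M] in
/-- Read at the scale's own resolution, the (E5-W) carrier is the (B2-W iso) carrier: `klWickIsoKernelAt … n n = klWickLegKernel … n 4`. -/
theorem klWickIsoKernelAt_self (β U μ : ℝ) (K : TrigPolyC4v) (n : ℕ) :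
    klWickIsoKernelAt L M β U μ K n n = klWickLegKernel L M β U μ K n 4 := rfl

/-- **(B2-W iso) ⇐ (B1-W) + (E5-W)**: with `B₂ := 2|U| + (C_W + κ₀·CR·Klam³)U²`, if `0 ≤ B₂` and `CF·B₂ + CF·(Klam U)² ≤ Klam·|U|`, then
`PairArrayAtW n ∧ IsoTupleL1AtW n` give `EndpointNormLineIsoW n` (twin of `endpointLineS_of_V2`'s first conjunct). -/
theorem endpointNormLineIsoW_of_pairArrayAtW {G : GeoConsts} (P : SplitConsts) (Q : EngConsts) {β U μ : ℝ} {K : TrigPolyC4v} {n : ℕ}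
    (hU : 0 ≤ 2 * |U| + (P.C_W + klLegKappa * Q.CR * P.Klam ^ 3) * U ^ 2)
    (hpair : PairArrayAtW L M P Q β U μ K n) (hiso : IsoTupleL1AtW L M G P β U μ K n)
    (harith : G.CF * (2 * |U| + (P.C_W + klLegKappa * Q.CR * P.Klam ^ 3) * U ^ 2) + G.CF * (P.Klam * U) ^ 2 ≤ P.Klam * |U|) :
    EndpointNormLineIsoW L M P β U μ K n := by
  intro Ω hΩ x₁
  have h' := hiso (2 * |U| + (P.C_W + klLegKappa * Q.CR * P.Klam ^ 3) * U ^ 2) hU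
    (fun k₁ hk₁ k₂ hk₂ k₃ _ => wickQuarticValueS_le_of_pairArrayAtW L M P Q hpair hk₁ hk₂ k₃) n le_rfl Ω hΩ x₁
  rw [klWickIsoKernelAt_self] at h'
  exact h'.trans harith

/-- **(B4-W) ⇐ (E4-W)** once `G.cE4 + Q.cE4·|U| ≤ P.Cd` (twin of `firstMoments_of_engineFirstMoments`). -/
theorem firstMomentsW_of_engineFirstMomentsW {G : GeoConsts} {P : SplitConsts} {Q : EngConsts} {β U μ : ℝ} {K : TrigPolyC4v}
    {n : ℕ} (hP : 0 ≤ P.Klam) (hCd : G.cE4 + Q.cE4 * |U| ≤ P.Cd) (h : EngineFirstMomentsW L M G P Q β U μ K n) :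
    FirstMomentsW L M P β U μ K n := by
  intro Ω i k
  refine (h Ω i k).trans ?_
  have h4 : (0 : ℝ) ≤ (4 : ℝ) ^ n := by positivity
  exact mul_le_mul_of_nonneg_right (mul_le_mul_of_nonneg_right (mul_le_mul_of_nonneg_right hCd hP) (abs_nonneg U)) h4

/-- **The per-scale child-1 step on the Wick carriers** (twin of `betaSplitAtS2_of_pairArrayAtV2`): (B1-W) `PairArrayAtW n`, (E5-W)
`IsoTupleL1AtW n` and (E4-W) `EngineFirstMomentsW n` give `BetaSplitAtW n` under the side conditions `CF·B₂ + CF·(Klam U)² ≤ Klam|U|`,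
`B₂ ≤ Klam|U|`, `cE4 + cE4′|U| ≤ Cd` (`B₂ := 2|U| + (C_W + κ₀·CR·Klam³)·U²`, `0 ≤ B₂`, `0 ≤ Klam`). -/
theorem betaSplitAtW_of_pairArrayAtW {G : GeoConsts} (P : SplitConsts) (Q : EngConsts) {β U μ : ℝ} {K : TrigPolyC4v} {n : ℕ}
    (hU : 0 ≤ 2 * |U| + (P.C_W + klLegKappa * Q.CR * P.Klam ^ 3) * U ^ 2) (hP : 0 ≤ P.Klam)
    (hpair : PairArrayAtW L M P Q β U μ K n) (hiso : IsoTupleL1AtW L M G P β U μ K n)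
    (hE4 : EngineFirstMomentsW L M G P Q β U μ K n)
    (harith : G.CF * (2 * |U| + (P.C_W + klLegKappa * Q.CR * P.Klam ^ 3) * U ^ 2) + G.CF * (P.Klam * U) ^ 2 ≤ P.Klam * |U|)
    (hK : 2 * |U| + (P.C_W + klLegKappa * Q.CR * P.Klam ^ 3) * U ^ 2 ≤ P.Klam * |U|) (hCd : G.cE4 + Q.cE4 * |U| ≤ P.Cd) :
    BetaSplitAtW L M G P Q β U μ K n :=
  ⟨hpair, ⟨endpointNormLineIsoW_of_pairArrayAtW L M P Q hU hpair hiso harith, quarticValueLineW_of_pairArrayAtW L M P Q hpair hK⟩,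
    firstMomentsW_of_engineFirstMomentsW L M hP hCd hE4⟩

end Model

end Summit.HubbardSuperconductivity.HubbardSuperconductivity.Theorems.KLRegimeSplit

end
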